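import Summits.QuantumFields.YangMills.Theorems.BalabanLadderNTCanonicalPackage
import Summits.QuantumFields.YangMills.Theorems.BalabanLadderNTCanonicalMarginThree
import Summits.QuantumFields.YangMills.Theorems.BalabanLadderNTReferenceTorusThreePoint
import Summits.QuantumFields.YangMills.Theses.BalabanLadder
import HarnessLib

/-!
# Crux `NT` (stmt-QuantumFields-19353), stub `stub_refpkgT : RefPkgT`: CANONICAL ENVELOPES VII — clause 5 against the intrinsic
# number `M₃ᶜᵃⁿ`, and `BalabanLadder.NT` BY NAME from ceilings + two floors beating two INTRINSIC numbers

Helper file (`--supports stmt-QuantumFields-19353`; Theses cone) of the fleet lead prover of crux `NT` (unit `ym-spine-19353-p1`,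
GEN 12); sequel of `…NTCanonicalPackage` (two-point half) and `…NTCanonicalMarginThree` (`margin₃_tendsto_canonical`).
Hypothesis-free, general compact `G`, any `r`.

With `‖w‖₁ = ∫|w|`, `I(F,H) = ∫_{(ℝ⁴)²}|F(p₀)||H(p₁)|/‖p₁−p₀‖⁴`, `J(f,g,h) = ∫_{(ℝ⁴)³}|f(p₀)||g(p₁)||h(p₂)|/min(‖p₁−p₀‖,‖p₂−p₁‖,‖p₂−p₀‖)⁸`:
`M₂ᶜᵃⁿ(v) = 2C₁²‖v‖₁²/κ⁸ + (C₂/κ⁴)I(θv,v)`,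
`M₃ᶜᵃⁿ(f,g,h) = 2((C₁C₂/κ⁸)(‖f‖₁I(g,h) + ‖g‖₁I(f,h) + ‖h‖₁I(f,g)) + C₁³‖f‖₁‖g‖₁‖h‖₁/κ¹²) + (C₃/κ⁴)J(f,g,h)`.

* **`clause₅_of_canonicalFloor`** — a canonical three-point floor `ε + M₃ᶜᵃⁿ ≤ |Q3_{β,L₀β,aβ}(f,g,h)|` on reference tori covering the
  supports gives the REGISTERED clause-5 floor-with-margin with `ε/2` for all large `β`;
* **`lowerBounds_snd_of_torusReference_canonical`** — E1/E2/E3-osc + that floor ⇒ clause (ii) of `LowerBounds` on every large torus;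
* **`nt_of_torusReferencePackage_canonical`** — **`BalabanLadder.NT` BY NAME** from: units `a > 0`, `a → 0`; E1/E2/E3-osc VERBATIM
  as registered; ONE positive-time `v` with `ε + M₂ᶜᵃⁿ(v) ≤ Q2(θv, v)` and ONE disjoint triple with `ε + M₃ᶜᵃⁿ(f,g,h) ≤ |Q3(f,g,h)|`
  on ONE torus per coupling (`aβ·L₀β ≥ σ+κ+1`).  Every lattice envelope, unit power and transfer constant of `stub_refpkgT`'s
  clauses 4–5 is discharged: what remains of the floors is two inequalities against two numbers that depend only on the
  witnesses and on `(C₁, C₂, C₃, κ)`.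

HONEST FRAMING.  Limits and bookkeeping over tree theorems; no floor and no large-`β` ceiling is proved; not AF, not NT, not the
seam, not the gap; not Clay.
-/

set_option autoImplicit false

noncomputable section

open scoped SchwartzMap
open MeasureTheory Filter Topology
open Literature.MathematicalPhysics.QuantumFieldTheory Literature.MathematicalPhysics.QuantumLattice
open Literature.Probability.LatticeModels
open Summit.QuantumFields.YangMills.Cruxes.OSLegsFromFemtoAndGap.DlrCollarTransfer
open Summit.QuantumFields.YangMills.Cruxes.NT.Reference
  (exists_sep_of_disjoint_tsupport lowerBounds_snd_of_torusReference)

namespace Summit.QuantumFields.YangMills.Cruxes.NT.CeilingPrice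

section Package

variable (G : Type) [Group G] [TopologicalSpace G] [IsTopologicalGroup G] [CompactSpace G]
  [MeasurableSpace G] [BorelSpace G] (r : LatticeRep G)

/-- **A canonical three-point floor gives the registered clause-5 floor-with-margin (with `ε/2`).**  Let `a > 0`, `a → 0`;
`f, g, h` with pairwise disjoint supports in the ball of radius `σ ≥ 0`; reference tori `L₀ β` with `σ ≤ a β·L₀ β` (`β ≥ β₅`); and
`ε + M₃ᶜᵃⁿ(f,g,h) ≤ |Q3_{β,L₀β,aβ}(f,g,h)|` for `β ≥ β₅`, `ε > 0`.  Then for all large `β` the registered lattice margin fits under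
`|Q3| − ε/2`. [folklore] -/
theorem clause₅_of_canonicalFloor (a : ℝ → ℝ) (ha : ∀ β, 0 < a β) (ha0 : Tendsto a atTop (𝓝 0)) {C₁ C₂ C₃ κ σ : ℝ}
    (hσ : 0 ≤ σ) {f g h : 𝓢(EuclideanSpace ℝ (Fin 4), ℝ)}
    (hfg : Disjoint (tsupport (f : EuclideanSpace ℝ (Fin 4) → ℝ)) (tsupport (g : EuclideanSpace ℝ (Fin 4) → ℝ)))
    (hgh : Disjoint (tsupport (g : EuclideanSpace ℝ (Fin 4) → ℝ)) (tsupport (h : EuclideanSpace ℝ (Fin 4) → ℝ)))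
    (hfh : Disjoint (tsupport (f : EuclideanSpace ℝ (Fin 4) → ℝ)) (tsupport (h : EuclideanSpace ℝ (Fin 4) → ℝ)))
    (hfσ : tsupport (f : EuclideanSpace ℝ (Fin 4) → ℝ) ⊆ Metric.closedBall 0 σ)
    (hgσ : tsupport (g : EuclideanSpace ℝ (Fin 4) → ℝ) ⊆ Metric.closedBall 0 σ)
    (hhσ : tsupport (h : EuclideanSpace ℝ (Fin 4) → ℝ) ⊆ Metric.closedBall 0 σ) {ε β₅ : ℝ} {L₀ : ℝ → ℕ} (hε : 0 < ε)
    (hcov : ∀ β : ℝ, β₅ ≤ β → σ ≤ a β * L₀ β)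
    (hfloor : ∀ β : ℝ, β₅ ≤ β →
      ε + (2 * (C₁ * C₂ / κ ^ 8 *
              ((∫ y, |f y|) * ∫ p : Fin 2 → EuclideanSpace ℝ (Fin 4), |g (p 0)| * |h (p 1)| / ‖p 1 - p 0‖ ^ 4) +
            C₁ * C₂ / κ ^ 8 *
              ((∫ y, |g y|) * ∫ p : Fin 2 → EuclideanSpace ℝ (Fin 4), |f (p 0)| * |h (p 1)| / ‖p 1 - p 0‖ ^ 4) +
            C₁ * C₂ / κ ^ 8 *
              ((∫ y, |h y|) * ∫ p : Fin 2 → EuclideanSpace ℝ (Fin 4), |f (p 0)| * |g (p 1)| / ‖p 1 - p 0‖ ^ 4) +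
            C₁ ^ 3 / κ ^ 12 * ((∫ y, |f y|) * (∫ y, |g y|) * (∫ y, |h y|))) +
        C₃ / κ ^ 4 * ∫ p : Fin 3 → EuclideanSpace ℝ (Fin 4), |f (p 0)| * |g (p 1)| * |h (p 2)| /
          min (min ‖p 1 - p 0‖ ‖p 2 - p 1‖) ‖p 2 - p 0‖ ^ 8) ≤ |Q3 G r β (L₀ β) (a β) f g h|) :
    ∃ β₅' : ℝ, β₅ ≤ β₅' ∧ ∀ β : ℝ, β₅' ≤ β →
      ε / 2 + ∑ x ∈ box 4 (L₀ β), ∑ y ∈ box 4 (L₀ β), ∑ z ∈ box 4 (L₀ β),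
          |f (a β • siteToE x)| * |g (a β • siteToE y)| * |h (a β • siteToE z)| *
            (2 * ((C₁ * (a β / κ) ^ 4) * (C₂ * (a β / κ) ^ 4 / (1 + ‖siteToE (z - y)‖) ^ 4) +
                  (C₁ * (a β / κ) ^ 4) * (C₂ * (a β / κ) ^ 4 / (1 + ‖siteToE (z - x)‖) ^ 4) +
                  (C₁ * (a β / κ) ^ 4) * (C₂ * (a β / κ) ^ 4 / (1 + ‖siteToE (y - x)‖) ^ 4) +
                  (C₁ * (a β / κ) ^ 4) * (C₁ * (a β / κ) ^ 4) * (C₁ * (a β / κ) ^ 4)) +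
              C₃ * (a β / κ) ^ 4 / (1 + min (min ‖siteToE (y - x)‖ ‖siteToE (z - y)‖) ‖siteToE (z - x)‖) ^ 8) ≤
        |Q3 G r β (L₀ β) (a β) f g h| := by
  -- a common separation of the three supports
  obtain ⟨δ₁, hδ₁, h₁⟩ := exists_sep_of_disjoint_tsupport hfg hfσ
  obtain ⟨δ₂, hδ₂, h₂⟩ := exists_sep_of_disjoint_tsupport hgh hgσ
  obtain ⟨δ₃, hδ₃, h₃⟩ := exists_sep_of_disjoint_tsupport hfh hfσ
  set δ' := min δ₁ (min δ₂ δ₃) with hδ'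
  have hδ' : 0 < δ' := lt_min hδ₁ (lt_min hδ₂ hδ₃)
  have hfg' : ∀ p q : EuclideanSpace ℝ (Fin 4), f p ≠ 0 → g q ≠ 0 → δ' ≤ ‖p - q‖ := fun p q hp hq =>
    (min_le_left _ _).trans (h₁ p q hp hq)
  have hgh' : ∀ p q : EuclideanSpace ℝ (Fin 4), g p ≠ 0 → h q ≠ 0 → δ' ≤ ‖p - q‖ := fun p q hp hq =>
    ((min_le_right _ _).trans (min_le_left _ _)).trans (h₂ p q hp hq)
  have hfh' : ∀ p q : EuclideanSpace ℝ (Fin 4), f p ≠ 0 → h q ≠ 0 → δ' ≤ ‖p - q‖ := fun p q hp hq =>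
    ((min_le_right _ _).trans (min_le_right _ _)).trans (h₃ p q hp hq)
  have hL : ∀ᶠ β in atTop, σ ≤ a β * L₀ β := eventually_atTop.2 ⟨β₅, hcov⟩
  have hlim := margin₃_tendsto_canonical hδ' hσ hfg' hgh' hfh' hfσ hgσ hhσ a L₀ ha ha0 hL C₁ C₂ C₃ κ
  set M := 2 * (C₁ * C₂ / κ ^ 8 *
          ((∫ y, |f y|) * ∫ p : Fin 2 → EuclideanSpace ℝ (Fin 4), |g (p 0)| * |h (p 1)| / ‖p 1 - p 0‖ ^ 4) +
        C₁ * C₂ / κ ^ 8 *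
          ((∫ y, |g y|) * ∫ p : Fin 2 → EuclideanSpace ℝ (Fin 4), |f (p 0)| * |h (p 1)| / ‖p 1 - p 0‖ ^ 4) +
        C₁ * C₂ / κ ^ 8 *
          ((∫ y, |h y|) * ∫ p : Fin 2 → EuclideanSpace ℝ (Fin 4), |f (p 0)| * |g (p 1)| / ‖p 1 - p 0‖ ^ 4) +
        C₁ ^ 3 / κ ^ 12 * ((∫ y, |f y|) * (∫ y, |g y|) * (∫ y, |h y|))) +
    C₃ / κ ^ 4 * ∫ p : Fin 3 → EuclideanSpace ℝ (Fin 4), |f (p 0)| * |g (p 1)| * |h (p 2)| /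
      min (min ‖p 1 - p 0‖ ‖p 2 - p 1‖) ‖p 2 - p 0‖ ^ 8 with hM
  have hev := (tendsto_order.1 hlim).2 (M + ε / 2) (by linarith)
  obtain ⟨βc, hβc⟩ := eventually_atTop.1 hev
  refine ⟨max β₅ βc, le_max_left _ _, fun β hβ => ?_⟩
  have hβ5 : β₅ ≤ β := le_trans (le_max_left _ _) hβ
  have h1 := hβc β (le_trans (le_max_right _ _) hβ)
  have h2 := hfloor β hβ5
  linarith

/-- **Clause (ii) of `LowerBounds` from a periodic reference with the CANONICAL three-point margin.**  `a > 0`, `a → 0`;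
`C₁, C₂, C₃ ≥ 0`, `σ, κ > 0`, `2(σ+κ) < ℓ`; (E1/E2/E3-osc) as registered; ONE triple `f, g, h` with pairwise disjoint supports in the
ball of radius `σ`, `ε > 0`, reference tori with `aβ·L₀β ≥ σ+κ+1` on which `ε + M₃ᶜᵃⁿ(f,g,h) ≤ |Q3_{β,L₀β,aβ}(f,g,h)|`.  Then
clause (ii) of `LowerBounds G r a` holds (with `ε/2`) on EVERY large torus. [folklore] -/
theorem lowerBounds_snd_of_torusReference_canonical (a : ℝ → ℝ) (ha₀ : ∀ β, 0 < a β) (ha : Tendsto a atTop (𝓝 0))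
    {C₁ C₂ C₃ ℓ σ κ : ℝ} (hC₁ : 0 ≤ C₁) (hC₂ : 0 ≤ C₂) (hC₃ : 0 ≤ C₃) (hσ : 0 < σ) (hκ : 0 < κ)
    (hℓ : 2 * (σ + κ) < ℓ)
    (hE1 : ∃ β₁ : ℝ, ∀ β : ℝ, β₁ ≤ β → ∀ (c : Fin 4 → ℤ) (b : ℕ), (b : ℝ) * a β ≤ ℓ →
      ∀ (η η' : LGConfig 4 G) (x : Fin 4 → ℤ), 1 ≤ depth c b x →
        |kerE G r β c b η (dens G r x) - kerE G r β c b η' (dens G r x)| ≤ C₁ / (depth c b x : ℝ) ^ 4)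
    (hE2 : ∃ β₂ : ℝ, ∀ β : ℝ, β₂ ≤ β → ∀ (c : Fin 4 → ℤ) (b : ℕ), (b : ℝ) * a β ≤ ℓ →
      ∀ (η η' : LGConfig 4 G) (x y : Fin 4 → ℤ), 1 ≤ depth c b x → 1 ≤ depth c b y →
        |kerCov G r β c b η (dens G r x) (dens G r y) - kerCov G r β c b η' (dens G r x) (dens G r y)| ≤
          C₂ / ((min (depth c b x) (depth c b y) : ℕ) : ℝ) ^ 4 / (1 + ‖siteToE (y - x)‖) ^ 4)
    (hE3 : ∃ β₃ : ℝ, ∀ β : ℝ, β₃ ≤ β → ∀ (c : Fin 4 → ℤ) (b : ℕ), (b : ℝ) * a β ≤ ℓ →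
      ∀ (η η' : LGConfig 4 G) (x y z : Fin 4 → ℤ), 1 ≤ depth c b x → 1 ≤ depth c b y → 1 ≤ depth c b z →
        |kerK3 G r β c b η x y z - kerK3 G r β c b η' x y z| ≤
          C₃ / ((min (min (depth c b x) (depth c b y)) (depth c b z) : ℕ) : ℝ) ^ 4 /
            (1 + min (min ‖siteToE (y - x)‖ ‖siteToE (z - y)‖) ‖siteToE (z - x)‖) ^ 8)
    (hR3 : ∃ (f g h : 𝓢(EuclideanSpace ℝ (Fin 4), ℝ)) (ε β₅ : ℝ) (L₀ : ℝ → ℕ),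
      Disjoint (tsupport (f : EuclideanSpace ℝ (Fin 4) → ℝ)) (tsupport (g : EuclideanSpace ℝ (Fin 4) → ℝ)) ∧
      Disjoint (tsupport (g : EuclideanSpace ℝ (Fin 4) → ℝ)) (tsupport (h : EuclideanSpace ℝ (Fin 4) → ℝ)) ∧
      Disjoint (tsupport (f : EuclideanSpace ℝ (Fin 4) → ℝ)) (tsupport (h : EuclideanSpace ℝ (Fin 4) → ℝ)) ∧
      tsupport (f : EuclideanSpace ℝ (Fin 4) → ℝ) ⊆ Metric.closedBall 0 σ ∧
      tsupport (g : EuclideanSpace ℝ (Fin 4) → ℝ) ⊆ Metric.closedBall 0 σ ∧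
      tsupport (h : EuclideanSpace ℝ (Fin 4) → ℝ) ⊆ Metric.closedBall 0 σ ∧ 0 < ε ∧
      ∀ β : ℝ, β₅ ≤ β → σ + κ + 1 ≤ a β * L₀ β ∧
        ε + (2 * (C₁ * C₂ / κ ^ 8 *
                ((∫ y, |f y|) * ∫ p : Fin 2 → EuclideanSpace ℝ (Fin 4), |g (p 0)| * |h (p 1)| / ‖p 1 - p 0‖ ^ 4) +
              C₁ * C₂ / κ ^ 8 *
                ((∫ y, |g y|) * ∫ p : Fin 2 → EuclideanSpace ℝ (Fin 4), |f (p 0)| * |h (p 1)| / ‖p 1 - p 0‖ ^ 4) +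
              C₁ * C₂ / κ ^ 8 *
                ((∫ y, |h y|) * ∫ p : Fin 2 → EuclideanSpace ℝ (Fin 4), |f (p 0)| * |g (p 1)| / ‖p 1 - p 0‖ ^ 4) +
              C₁ ^ 3 / κ ^ 12 * ((∫ y, |f y|) * (∫ y, |g y|) * (∫ y, |h y|))) +
          C₃ / κ ^ 4 * ∫ p : Fin 3 → EuclideanSpace ℝ (Fin 4), |f (p 0)| * |g (p 1)| * |h (p 2)| /
            min (min ‖p 1 - p 0‖ ‖p 2 - p 1‖) ‖p 2 - p 0‖ ^ 8) ≤ |Q3 G r β (L₀ β) (a β) f g h|) :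
    ∃ (f g h : 𝓢(EuclideanSpace ℝ (Fin 4), ℝ)) (ε β₅ Λ₅ : ℝ),
      Disjoint (tsupport (f : EuclideanSpace ℝ (Fin 4) → ℝ)) (tsupport (g : EuclideanSpace ℝ (Fin 4) → ℝ)) ∧
      Disjoint (tsupport (g : EuclideanSpace ℝ (Fin 4) → ℝ)) (tsupport (h : EuclideanSpace ℝ (Fin 4) → ℝ)) ∧
      Disjoint (tsupport (f : EuclideanSpace ℝ (Fin 4) → ℝ)) (tsupport (h : EuclideanSpace ℝ (Fin 4) → ℝ)) ∧
      0 < ε ∧ ∀ β : ℝ, β₅ ≤ β → ∀ L : ℕ, Λ₅ ≤ a β * L → ε ≤ |Q3 G r β L (a β) f g h| := by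
  obtain ⟨f, g, h, ε, β₅, L₀, hfg, hgh, hfh, hfσ, hgσ, hhσ, hε, HR⟩ := hR3
  have hcov : ∀ β : ℝ, β₅ ≤ β → σ ≤ a β * L₀ β := fun β hβ => by linarith [(HR β hβ).1]
  obtain ⟨β₅', hβ₅', H5⟩ := clause₅_of_canonicalFloor G r a ha₀ ha (C₁ := C₁) (C₂ := C₂) (C₃ := C₃) (κ := κ) hσ.le hfg
    hgh hfh hfσ hgσ hhσ hε hcov (fun β hβ => (HR β hβ).2)
  exact lowerBounds_snd_of_torusReference G r a ha₀ ha hC₁ hC₂ hC₃ hσ hκ hℓ hE1 hE2 hE3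
    ⟨f, g, h, ε / 2, β₅', L₀, hfg, hgh, hfh, hfσ, hgσ, hhσ, by linarith,
      fun β hβ => ⟨(HR β (hβ₅'.trans hβ)).1, H5 β hβ⟩⟩

end Package

/-- **`BalabanLadder.NT` BY NAME from the reference ceilings and two floors beating two INTRINSIC numbers.**  For every compact
simple `G`: a lattice representation `r`, units `a > 0` with `a → 0`; constants `C₁, C₂, C₃ ≥ 0`, femto range `ℓ`, support radius
`σ > 0`, collar `κ > 0`, `2(σ+κ) < ℓ`; E1/E2/E3-osc VERBATIM as in the registered `RefPkgT`; ONE positive-time witness `v` in the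
ball of radius `σ` with `ε + M₂ᶜᵃⁿ(v) ≤ Q2_{β,L₀β,aβ}(θv, v)` and ONE triple `f, g, h` with pairwise disjoint supports in that ball
with `ε + M₃ᶜᵃⁿ(f,g,h) ≤ |Q3_{β,L₀β,aβ}(f,g,h)|`, on ONE torus `aβ·L₀β ≥ σ+κ+1` per coupling `β ≥ β₅`.  Then `NT`. [folklore] -/
theorem nt_of_torusReferencePackage_canonical
    (hpk : ∀ (G : Type) [Group G] [TopologicalSpace G] [IsTopologicalGroup G] [CompactSpace G],
      IsCompactSimpleLieGroup G → letI : MeasurableSpace G := borel G; haveI : BorelSpace G := ⟨rfl⟩;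
      ∃ (r : LatticeRep G) (a : ℝ → ℝ), (∀ β, 0 < a β) ∧ Tendsto a atTop (𝓝 0) ∧
      ∃ (C₁ C₂ C₃ ℓ σ κ : ℝ), 0 ≤ C₁ ∧ 0 ≤ C₂ ∧ 0 ≤ C₃ ∧ 0 < σ ∧ 0 < κ ∧ 2 * (σ + κ) < ℓ ∧
      (∃ β₁ : ℝ, ∀ β : ℝ, β₁ ≤ β → ∀ (c : Fin 4 → ℤ) (b : ℕ), (b : ℝ) * a β ≤ ℓ →
        ∀ (η η' : LGConfig 4 G) (x : Fin 4 → ℤ), 1 ≤ depth c b x →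
          |kerE G r β c b η (dens G r x) - kerE G r β c b η' (dens G r x)| ≤ C₁ / (depth c b x : ℝ) ^ 4) ∧
      (∃ β₂ : ℝ, ∀ β : ℝ, β₂ ≤ β → ∀ (c : Fin 4 → ℤ) (b : ℕ), (b : ℝ) * a β ≤ ℓ →
        ∀ (η η' : LGConfig 4 G) (x y : Fin 4 → ℤ), 1 ≤ depth c b x → 1 ≤ depth c b y →
          |kerCov G r β c b η (dens G r x) (dens G r y) - kerCov G r β c b η' (dens G r x) (dens G r y)| ≤
            C₂ / ((min (depth c b x) (depth c b y) : ℕ) : ℝ) ^ 4 / (1 + ‖siteToE (y - x)‖) ^ 4) ∧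
      (∃ β₃ : ℝ, ∀ β : ℝ, β₃ ≤ β → ∀ (c : Fin 4 → ℤ) (b : ℕ), (b : ℝ) * a β ≤ ℓ →
        ∀ (η η' : LGConfig 4 G) (x y z : Fin 4 → ℤ), 1 ≤ depth c b x → 1 ≤ depth c b y → 1 ≤ depth c b z →
          |kerK3 G r β c b η x y z - kerK3 G r β c b η' x y z| ≤
            C₃ / ((min (min (depth c b x) (depth c b y)) (depth c b z) : ℕ) : ℝ) ^ 4 /
              (1 + min (min ‖siteToE (y - x)‖ ‖siteToE (z - y)‖) ‖siteToE (z - x)‖) ^ 8) ∧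
      (∃ (v : 𝓢(EuclideanSpace ℝ (Fin 4), ℝ)) (ε β₅ : ℝ) (L₀ : ℝ → ℕ),
        tsupport (v : EuclideanSpace ℝ (Fin 4) → ℝ) ⊆ {y | 0 < y 0} ∧
        tsupport (v : EuclideanSpace ℝ (Fin 4) → ℝ) ⊆ Metric.closedBall 0 σ ∧ 0 < ε ∧
        ∀ β : ℝ, β₅ ≤ β → σ + κ + 1 ≤ a β * L₀ β ∧
          ε + (2 * C₁ ^ 2 * (∫ y, |v y|) ^ 2 / κ ^ 8 +
            C₂ / κ ^ 4 * ∫ p : Fin 2 → EuclideanSpace ℝ (Fin 4),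
              |thetaTest 4 v (p 0)| * |v (p 1)| / ‖p 1 - p 0‖ ^ 4) ≤ Q2 G r β (L₀ β) (a β) (thetaTest 4 v) v) ∧
      (∃ (f g h : 𝓢(EuclideanSpace ℝ (Fin 4), ℝ)) (ε β₅ : ℝ) (L₀ : ℝ → ℕ),
        Disjoint (tsupport (f : EuclideanSpace ℝ (Fin 4) → ℝ)) (tsupport (g : EuclideanSpace ℝ (Fin 4) → ℝ)) ∧
        Disjoint (tsupport (g : EuclideanSpace ℝ (Fin 4) → ℝ)) (tsupport (h : EuclideanSpace ℝ (Fin 4) → ℝ)) ∧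
        Disjoint (tsupport (f : EuclideanSpace ℝ (Fin 4) → ℝ)) (tsupport (h : EuclideanSpace ℝ (Fin 4) → ℝ)) ∧
        tsupport (f : EuclideanSpace ℝ (Fin 4) → ℝ) ⊆ Metric.closedBall 0 σ ∧
        tsupport (g : EuclideanSpace ℝ (Fin 4) → ℝ) ⊆ Metric.closedBall 0 σ ∧
        tsupport (h : EuclideanSpace ℝ (Fin 4) → ℝ) ⊆ Metric.closedBall 0 σ ∧ 0 < ε ∧
        ∀ β : ℝ, β₅ ≤ β → σ + κ + 1 ≤ a β * L₀ β ∧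
          ε + (2 * (C₁ * C₂ / κ ^ 8 *
                  ((∫ y, |f y|) * ∫ p : Fin 2 → EuclideanSpace ℝ (Fin 4), |g (p 0)| * |h (p 1)| / ‖p 1 - p 0‖ ^ 4) +
                C₁ * C₂ / κ ^ 8 *
                  ((∫ y, |g y|) * ∫ p : Fin 2 → EuclideanSpace ℝ (Fin 4), |f (p 0)| * |h (p 1)| / ‖p 1 - p 0‖ ^ 4) +
                C₁ * C₂ / κ ^ 8 *
                  ((∫ y, |h y|) * ∫ p : Fin 2 → EuclideanSpace ℝ (Fin 4), |f (p 0)| * |g (p 1)| / ‖p 1 - p 0‖ ^ 4) +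
                C₁ ^ 3 / κ ^ 12 * ((∫ y, |f y|) * (∫ y, |g y|) * (∫ y, |h y|))) +
            C₃ / κ ^ 4 * ∫ p : Fin 3 → EuclideanSpace ℝ (Fin 4), |f (p 0)| * |g (p 1)| * |h (p 2)| /
              min (min ‖p 1 - p 0‖ ‖p 2 - p 1‖) ‖p 2 - p 0‖ ^ 8) ≤ |Q3 G r β (L₀ β) (a β) f g h|)) :
    Summit.QuantumFields.YangMills.Theses.BalabanLadder.NT := by
  intro G _ _ _ _ hG
  letI : MeasurableSpace G := borel G
  haveI : BorelSpace G := ⟨rfl⟩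
  obtain ⟨r, a, ha₀, ha, C₁, C₂, C₃, ℓ, σ, κ, hC₁, hC₂, hC₃, hσ, hκ, hℓ, hE1, hE2, hE3, hR2, hR3⟩ := hpk G hG
  exact ⟨r, a, ha₀, ha,
    lowerBounds_fst_of_torusReference_canonical G r a ha₀ ha hC₁ hC₂ hσ hκ hℓ hE1 hE2 hR2,
    lowerBounds_snd_of_torusReference_canonical G r a ha₀ ha hC₁ hC₂ hC₃ hσ hκ hℓ hE1 hE2 hE3 hR3⟩

end Summit.QuantumFields.YangMills.Cruxes.NT.CeilingPrice

end
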